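import Summits.BirchSwinnertonDyer.BirchSwinnertonDyer.Theorems.ByReductionTypeAtTwoSupersingularHondaSystemAtTwoDual
import Summits.BirchSwinnertonDyer.BirchSwinnertonDyer.Theorems.ByReductionTypeAtTwoSupersingularHondaSystemAtTwoPrimalZero
import HarnessLib

/-!
# Sprung's Honda system AT `p = 2`, III: **(C1) `F1Sign2.HondaSystemAtTwoExists` ON THE SUB-ROW `a₂ = 0`** — transport
# `ℚ_[2] → ℚ_v` of the primal data with the bottom relation, (GEN₀) from non-divisibility, and the dualisation of file I

Seat `bsd-2adic-tower-1` GEN 66, hand H2-C1 (pen GEN 40 SUMMON 20260831T155847Z). Sequel of `…SupersingularHondaSystemAtTwoDual` (I: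
`SSHondaTwo.isHondaSystemAtTwo_of_primal`) and `…SupersingularHondaSystemAtTwoPrimalZero` (II: the primal data at `ℚ_[2]` with
`Tr_{1/0} d_1 = −4•d_0`, sub-row `a₂ = 0`).

WHAT (THEOREMS ONLY; no definition, no named fact, no instance, no `sorry`; route-independent — no `Theses` import):
* §1 (any `K ⊆ E ≃ E'`, `Φ : Ē ≃ Ē'` over `φ`, `ι' = Φ ∘ ι`, any `p`) `primalHondaR1_modelTransport` — the primal package
  «(L) ∧ (R1) `Tr_{1/0} d_1 = −(4•d_0)` ∧ (TR) ∧ (GEN, multiplier `q`) ∧ (NONDIV)» moves along the model isomorphism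
  (w3's `SignedEC.hondaSystemNonDiv_modelTransport` + one more `modelMap_localTraceOfEmb`); `primalHondaR1_adicCompletion_of_padic`
  — from (`ℚ_[p]`, every `ι`) to (`ℚ_v`, `closureEmb`) (`SignedEC.exists_model_padic_adicCompletion`).
* §2 **`hondaSystemAtTwoExists_of_frobeniusTrace_eq_zero`** — for `W/ℚ` elliptic and globally minimal with good reduction at `2`
  and **`a₂(W) = 0`**, the cyclotomic `(κ, γ)`, `v ∋ 2`, and a local lift `g` of `γ`: `∃ cneg c, IsHondaSystemAtTwo κ (closureEmb ℚ_v)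
  W (W.frobeniusTrace 2) g cneg c` — the body of (C1) `F1Sign2.HondaSystemAtTwoExists` with its hypothesis `2 ∣ a₂` specialised to
  `a₂ = 0` (the `a₂ = ±2` rows remain: they need Sprung's logarithm of type `T² − a₂T + 2` in place of Kobayashi's `T² + 2`).
  Assembly: II transported (§1) gives `d` over `ℚ_v` with (L) (R1) (TR) (GEN) (NONDIV); (GEN₀) `E(ℚ_v) ⊆ ℤd_0 + 2E(ℚ_v)` is w3's
  `SignedEC.plusGenZero_two_of_ne_two_nsmul` (Milne I 3.3 + `E(ℚ₂)[2] = 0`); with `cneg := −d_0`, `c := d`, `N := 1` the three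
  relations of `IsHondaSystemAtTwo` at `a₂ = 0` read `c_0 = (−1)•cneg`, `Tr_{1/0} c_1 = 0•c_0 + 4•cneg`, `Tr_{n+1/n} c_{n+1} = −c_{n−1}`,
  and file I's `isHondaSystemAtTwo_of_primal` yields the four dual clauses.
HONEST FRAMING: proves the binder (C1) on the `a₂ = 0` sub-row only; closes no stub and no item at the `∀`-level (the registered
conjuncts consume (C1) for all `a₂ ∈ {0, ±2}`); nothing booked; BSD is not proved by any of this.

References: [Sprung2012] F. Sprung, J. Number Theory 132 (2012), Thm. 2.2 (p. 1487), Cor. 2.10, Lemma 2.3; [Kobayashi2003]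
S. Kobayashi, Invent. Math. 152 (2003), Lemma 8.9, Props. 8.11–8.12; [MilneADT2006] I Lemma 3.3; [SerreGaloisCohomology1997] II.§1.1;
cell memo MEMO-imc §10.90 / REF1 §139 (B0), R3.
-/

set_option autoImplicit false
-- the Theorems namespace of this sub repeats the summit name by design (D-0017 nested layout)
set_option linter.dupNamespace false

noncomputable section

open scoped Classical NumberField

universe u

namespace Summit.BirchSwinnertonDyer.BirchSwinnertonDyer.Theorems.SSHondaTwo

open NumberField IsDedekindDomain WeierstrassCurve Literature.NumberTheory.EllipticCurves
  Literature.NumberTheory.GaloisRepresentations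
  Literature.NumberTheory.EllipticCurves.ZpExtension Literature.NumberTheory.EllipticCurves.Kobayashi2003
  Literature.NumberTheory.EllipticCurves.Rank1Residual
  Summit.BirchSwinnertonDyer.Rank1Residual.Additive.LocalTransport
  Summit.BirchSwinnertonDyer.BirchSwinnertonDyer.Theorems.SignedEC
  Summit.BirchSwinnertonDyer.Rank1Residual.F1Sign2

/-! ## §1 Transport of the primal package with the bottom relation -/

section Generic

variable {K : Type u} [Field K] {E : Type u} [Field E] [Algebra K E] {E' : Type u} [Field E'] [Algebra K E']
  (Φ : AlgebraicClosure E ≃ₐ[K] AlgebraicClosure E') (φ : E ≃+* E')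
  (hf : ∀ y : E, Φ (algebraMap E (AlgebraicClosure E) y) = algebraMap E' (AlgebraicClosure E') (φ y))
  (ι : AlgebraicClosure K →ₐ[K] AlgebraicClosure E) (ι' : AlgebraicClosure K →ₐ[K] AlgebraicClosure E')
  (hcompat : ∀ z : AlgebraicClosure K, ι' z = Φ (ι z))
  (W : WeierstrassCurve K) (T : localPoints W E →+ localPoints W E')
  (hT : ∀ P : localPoints W E, T P =
    WeierstrassCurve.Affine.Point.map (W' := W) (Φ : AlgebraicClosure E →ₐ[K] AlgebraicClosure E')
      (show (W.baseChange (AlgebraicClosure E)).toAffine.Point from P))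
  {p : ℕ} [Fact p.Prime] (κ : ZpExtension K p)

include hf hcompat hT in
/-- **The primal package with the bottom relation moves along an isomorphism of models**: (L), (R1) `Tr_{1/0} d_1 = −(4•d_0)`,
(TR), (GEN) with multiplier `q`, (NONDIV) for `d` at (`E`, `ι`) yield the same for `T ∘ d` at (`E'`, `ι'`) (`T` is a bijection of
layer points commuting with traces, Galois orbits and multiples). [cite: SerreGaloisCohomology1997, II.§1.1] [cite: Kobayashi2003, Def. 1.1] -/
theorem primalHondaR1_modelTransport (q : ℕ)
    (h : ∃ d : ℕ → localPoints W E,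
      (∀ m, d m ∈ localLayerPointsOfEmb κ ι W m) ∧
      localTraceOfEmb κ ι W 0 1 (d 1) = -(4 • d 0) ∧
      (∀ m, localTraceOfEmb κ ι W (m + 1) (m + 2) (d (m + 2)) = -d m) ∧
      (∀ m : ℕ, 1 ≤ m → ∀ P ∈ localLayerPointsOfEmb κ ι W m,
        ∃ B ∈ AddSubgroup.closure (Set.range fun σ : Field.absoluteGaloisGroup E ↦ σ • d m),
          ∃ P' ∈ localLayerPointsOfEmb κ ι W (m - 1),
          ∃ R ∈ localLayerPointsOfEmb κ ι W m, P = B + P' + q • R) ∧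
      (∀ b ∈ localLayerPointsOfEmb κ ι W 0, d 0 ≠ q • b)) :
    ∃ d : ℕ → localPoints W E',
      (∀ m, d m ∈ localLayerPointsOfEmb κ ι' W m) ∧
      localTraceOfEmb κ ι' W 0 1 (d 1) = -(4 • d 0) ∧
      (∀ m, localTraceOfEmb κ ι' W (m + 1) (m + 2) (d (m + 2)) = -d m) ∧
      (∀ m : ℕ, 1 ≤ m → ∀ P ∈ localLayerPointsOfEmb κ ι' W m,
        ∃ B ∈ AddSubgroup.closure (Set.range fun σ : Field.absoluteGaloisGroup E' ↦ σ • d m),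
          ∃ P' ∈ localLayerPointsOfEmb κ ι' W (m - 1),
          ∃ R ∈ localLayerPointsOfEmb κ ι' W m, P = B + P' + q • R) ∧
      (∀ b ∈ localLayerPointsOfEmb κ ι' W 0, d 0 ≠ q • b) := by
  have hmem := modelMap_mem_localLayerPointsOfEmb_iff Φ φ hf ι ι' hcompat W T hT κ
  obtain ⟨d, hd, hR1, htr, hgen, hnd⟩ := h
  obtain ⟨d', hd', htr', hgen', hnd'⟩ :=
    hondaSystemNonDiv_modelTransport Φ φ hf ι ι' hcompat W T hT κ q ⟨d, hd, htr, hgen, hnd⟩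
  -- w3's transport hides its witness; redo it with the displayed witness `T ∘ d`
  refine ⟨fun m ↦ T (d m), fun m ↦ (hmem m _).mpr (hd m), ?_, fun m ↦ ?_, fun m hm P' hP' ↦ ?_,
    nonDiv_modelTransport Φ φ hf ι ι' hcompat W T hT κ q hnd⟩
  · rw [← modelMap_localTraceOfEmb Φ φ hf ι ι' hcompat W T hT κ 0 1 (hd 1), hR1, map_neg, map_nsmul]
  · rw [← modelMap_localTraceOfEmb Φ φ hf ι ι' hcompat W T hT κ (m + 1) (m + 2) (hd (m + 2)), htr, map_neg]
  · obtain ⟨P, rfl⟩ := modelMap_surjective Φ W T hT P'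
    obtain ⟨B, hB, P₁, hP₁, R, hR, hPe⟩ := hgen m hm P ((hmem m P).mp hP')
    refine ⟨T B, ?_, T P₁, (hmem _ _).mpr hP₁, T R, (hmem _ _).mpr hR, by rw [hPe, map_add, map_add, map_nsmul]⟩
    rw [← map_modelMap_closure_orbit Φ φ hf W T hT]
    exact AddSubgroup.mem_map_of_mem T hB

end Generic

/-- **The primal package with the bottom relation: (`ℚ_[p]`, every `ι`) ⟹ (`ℚ_v`, `closureEmb`)** at the place `v ∋ p`
(`Φ : ℚ̄_p ≃ ℚ̄_v` over `ℚ_[p] ≃ ℚ_v`, `closureEmb = Φ ∘ ι`). [cite: SerreGaloisCohomology1997, II.§1.1] [cite: MilneFT2022, Ch. 6] -/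
theorem primalHondaR1_adicCompletion_of_padic {p : ℕ} [Fact p.Prime] (W : WeierstrassCurve ℚ) (κ : ZpExtension ℚ p) (q : ℕ)
    (v : HeightOneSpectrum (𝓞 ℚ)) (hv : (p : 𝓞 ℚ) ∈ v.asIdeal)
    (h : ∀ ι : AlgebraicClosure ℚ →ₐ[ℚ] AlgebraicClosure ℚ_[p], ∃ d : ℕ → localPoints W ℚ_[p],
      (∀ m, d m ∈ localLayerPointsOfEmb κ ι W m) ∧
      localTraceOfEmb κ ι W 0 1 (d 1) = -(4 • d 0) ∧
      (∀ m, localTraceOfEmb κ ι W (m + 1) (m + 2) (d (m + 2)) = -d m) ∧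
      (∀ m : ℕ, 1 ≤ m → ∀ P ∈ localLayerPointsOfEmb κ ι W m,
        ∃ B ∈ AddSubgroup.closure (Set.range fun σ : Field.absoluteGaloisGroup ℚ_[p] ↦ σ • d m),
          ∃ P' ∈ localLayerPointsOfEmb κ ι W (m - 1),
          ∃ R ∈ localLayerPointsOfEmb κ ι W m, P = B + P' + q • R) ∧
      (∀ b ∈ localLayerPointsOfEmb κ ι W 0, d 0 ≠ q • b)) :
    ∃ d : ℕ → localPoints W (v.adicCompletion ℚ),
      (∀ m, d m ∈ localLayerPointsOfEmb κ (closureEmb (K := ℚ) (v.adicCompletion ℚ)) W m) ∧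
      localTraceOfEmb κ (closureEmb (K := ℚ) (v.adicCompletion ℚ)) W 0 1 (d 1) = -(4 • d 0) ∧
      (∀ m, localTraceOfEmb κ (closureEmb (K := ℚ) (v.adicCompletion ℚ)) W (m + 1) (m + 2) (d (m + 2)) = -d m) ∧
      (∀ m : ℕ, 1 ≤ m → ∀ P ∈ localLayerPointsOfEmb κ (closureEmb (K := ℚ) (v.adicCompletion ℚ)) W m,
        ∃ B ∈ AddSubgroup.closure (Set.range fun σ : Field.absoluteGaloisGroup (v.adicCompletion ℚ) ↦ σ • d m),
          ∃ P' ∈ localLayerPointsOfEmb κ (closureEmb (K := ℚ) (v.adicCompletion ℚ)) W (m - 1),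
          ∃ R ∈ localLayerPointsOfEmb κ (closureEmb (K := ℚ) (v.adicCompletion ℚ)) W m, P = B + P' + q • R) ∧
      (∀ b ∈ localLayerPointsOfEmb κ (closureEmb (K := ℚ) (v.adicCompletion ℚ)) W 0, d 0 ≠ q • b) := by
  obtain ⟨Φ, φ, hf, ι, hcompat⟩ := exists_model_padic_adicCompletion (p := p) hv
  exact primalHondaR1_modelTransport Φ φ hf ι (closureEmb (K := ℚ) (v.adicCompletion ℚ)) hcompat W
    (show localPoints W ℚ_[p] →+ localPoints W (v.adicCompletion ℚ) from
      WeierstrassCurve.Affine.Point.map (W' := W) (Φ : AlgebraicClosure ℚ_[p] →ₐ[ℚ] AlgebraicClosure (v.adicCompletion ℚ)))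
    (fun _ ↦ rfl) κ q (h ι)

/-! ## §2 (C1) on the sub-row `a₂ = 0` -/

/-- **(C1) `F1Sign2.HondaSystemAtTwoExists` ON THE SUB-ROW `a₂ = 0`.** For `W/ℚ` elliptic and globally minimal with good reduction
at `2` and `a₂(W) = 0`, the cyclotomic `ℤ₂`-extension `κ` with topological generator `γ` (a cyclotomic variable), the place `v ∋ 2`
and a local lift `g` of `γ`, there are `cneg ∈ E(ℚ_v)` and `c : ℕ → E(ℚ̄_v)` with
`IsHondaSystemAtTwo κ (closureEmb ℚ_v) W (W.frobeniusTrace 2) g cneg c` — Sprung's Thm. 2.2 in `ℤ₂`-tower form AT `p = 2` with the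
COMPUTED bottom constants, on the row `a₂ = 0`: `cneg := −d_0`, `c := d` for the tree's plus Honda points `d` (K3/K4, HONDA⁺@2),
the bottom relation of file II, (GEN₀) by Milne I 3.3, and the dualisation of file I. The binders are those of
`F1Sign2.HondaSystemAtTwoExists` with `2 ∣ a₂` specialised to `a₂ = 0` (`γ`, `IsCyclotomicVariable` are carried, not used).
[cite: Sprung2012, Thm. 2.2 (p. 1487), Cor. 2.10 (p. 1489), Lemma 2.3] [cite: Kobayashi2003, Lemma 8.9, Prop. 8.11, Prop. 8.12]
[cite: MilneADT2006, I Lemma 3.3] -/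
theorem hondaSystemAtTwoExists_of_frobeniusTrace_eq_zero :
    ∀ (W : WeierstrassCurve ℚ) [W.IsElliptic] [W.IsGloballyMinimal],
      W.HasGoodReductionAtPrime 2 → W.frobeniusTrace 2 = 0 →
      ∀ (κ : ZpExtension ℚ 2) (γ : Field.absoluteGaloisGroup ℚ),
        κ.IsCyclotomic → κ.IsTopGenerator γ → IsCyclotomicVariable 2 γ →
      ∀ (v : HeightOneSpectrum (𝓞 ℚ)), (2 : 𝓞 ℚ) ∈ v.asIdeal →
      ∀ (g : Field.absoluteGaloisGroup (v.adicCompletion ℚ)),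
        κ.IsTopGenerator (resGalOfEmb (closureEmb (K := ℚ) (v.adicCompletion ℚ)) g) →
      ∃ (cneg : localPoints W (v.adicCompletion ℚ)) (c : ℕ → localPoints W (v.adicCompletion ℚ)),
        IsHondaSystemAtTwo κ (closureEmb (K := ℚ) (v.adicCompletion ℚ)) W (W.frobeniusTrace 2) g cneg c := by
  intro W _ _ hgood ha κ γ hκ _ _ v hv g hg
  have hss : GoodSS W 2 := ⟨hgood, by rw [ha]; exact dvd_zero _⟩
  set ι := closureEmb (K := ℚ) (v.adicCompletion ℚ) with hι
  obtain ⟨d, hL, hR1, hTR, hGEN, hND⟩ := primalHondaR1_adicCompletion_of_padic W κ 2 v (by exact_mod_cast hv)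
    fun ι₂ ↦ primalHondaAtTwo_padic_of_frobeniusTrace_eq_zero W hss ha κ hκ ι₂
  have hGEN0 := plusGenZero_two_of_ne_two_nsmul W hss κ v hv ι (hL 0) hND
  have heven : (2 : ℤ) ∣ W.frobeniusTrace 2 := by rw [ha]; exact dvd_zero _
  refine ⟨-d 0, d, isHondaSystemAtTwo_of_primal ι W κ (isUnit_sq_sub_two_mul_sub_one_of_even heven) hg
    (N := 1) (Nat.coprime_one_left 2) (neg_mem (hL 0)) hL ?_ ?_ ?_ ?_ ?_⟩
  · -- `c_0 = (a² − 2a − 1) • cneg` with `a = 0`, `cneg = −d_0`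
    rw [ha, show ((0 : ℤ) ^ 2 - 2 * 0 - 1) = -1 by norm_num, neg_one_zsmul, neg_neg]
  · -- `Tr_{1/0} c_1 = a • c_0 + (4 − 2a) • cneg`
    rw [hR1, ha, zero_zsmul, zero_add, show ((4 : ℤ) - 2 * 0) = ((4 : ℕ) : ℤ) by norm_num, natCast_zsmul, smul_neg]
  · -- `Tr_{n+1/n} c_{n+1} = a • c_n − c_{n−1}` for `n ≥ 1`
    intro n hn
    obtain ⟨m, rfl⟩ := Nat.exists_eq_add_of_le' hn
    rw [ha, zero_zsmul, zero_sub, Nat.add_sub_cancel]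
    exact hTR m
  · intro m hm P hP
    obtain ⟨B, hB, P', hP', R, hR, h⟩ := hGEN m hm P hP
    exact ⟨B, hB, P', hP', R, hR, by rw [one_nsmul]; exact h⟩
  · intro P hP
    obtain ⟨a, R, hR, h⟩ := hGEN0 P hP
    exact ⟨-a, R, hR, by rw [one_nsmul, h, neg_zsmul, zsmul_neg, neg_neg]⟩

end Summit.BirchSwinnertonDyer.BirchSwinnertonDyer.Theorems.SSHondaTwo

end
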